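import Literature.Analysis.FluidPDE.CaloricBackwardKernels
import HarnessLib

/-!
# Forward heat kernels truncated in time and their `L^s` bounds

Analysis/FluidPDE support file (all results proved) for the discharge of the named fact
`Literature.Analysis.FluidPDE.HeatDivFormInteriorImprovement` (`NSBoundedVorticityReduction.lean`;
Robinson–Rodrigo–Sadowski 2016, §13.3.2 Step 2 with Thms. D.6–D.7: the interior `L^m → L^r`
improvement for `∂ₜw - Δw = div g`). In the duality proof the localised solution `W` is
represented by **forward** space–time potentials `Ǩ ⋆ h`, `Ǩ(v) = K(-v)` the reflection of a
backward kernel `K = backKernel κ` of `CaloricBackwardKernels.lean` (`κ a` the kernel after the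
elapsed time `a > 0`: the heat kernel `G_a` or its gradient `∂ᵥG_a`). Since the data have
bounded time support and only a bounded time window is observed, the kernels may be truncated at
a finite time `T`; the truncated kernels are **globally** in `L^s(ℝ × E)` for
`1 ≤ s < 1 + 2/d` (heat kernel) resp. `1 ≤ s < 1 + 1/(d+1)` (gradient) — in `ℝ³`, `s < 5/3`
resp. `s < 5/4`, the exponents behind the condition `5/m < 5/r + 1` of RRS Thm. D.7 via Young's
inequality `1 + 1/r = 1/s + 1/m`.

## Contents

* `fwdKernel κ (τ, y) = backKernel κ (-τ, -y)` (`= κ τ (-y)` for `τ > 0`, `0` for `τ ≤ 0`) and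
  its truncation `fwdKernelCut κ T` (`= 0` for `τ ≥ T`); unfolding lemmas, measurability;
* `lintegral_rpow_enorm_fwdKernelCut_le` — the generic bound
  `∫∫ |fwdKernelCut κ T|^s ≤ ∫_{0<a<T} (sup|κ a|)^{s-1} ‖κ a‖₁ da` (interpolation between the
  sup and the `L¹` slice bounds; Tonelli);
* `memLp_fwdKernelCut_heatKernel`, `memLp_fwdKernelCut_heatKernelGrad` — the two memberships,
  from the tree's bounds `G_a ≤ (4πa)^{-d/2}`, `∫ G_a = 1`, `|∂ᵥG_a| ≤ C‖v‖a^{-(d+1)/2}`,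
  `∫ |∂ᵥG_a| ≤ 2^{d/2}‖v‖a^{-1/2}` and the integrability of `a^e` on `(0, T)` for `e > -1`.

Standard heat-kernel calculus (RRS 2016, proof of Thm. D.4 / Thms. D.6–D.7, where the same
powers of `t` appear; Evans, *PDE*, §2.3.1).

## References

* J. C. Robinson, J. L. Rodrigo, W. Sadowski, *The Three-Dimensional Navier–Stokes Equations*,
  CUP 2016, App. D, Thm. D.4 and Thms. D.6–D.7 (pp. 293–296 of the held copy).
  [`RobinsonRodrigoSadowskiCUP2016`]
-/

noncomputable section

open MeasureTheory Set Function Filter Topology Real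
open scoped ENNReal NNReal

namespace Literature.Analysis.FluidPDE

variable {E : Type*} [NormedAddCommGroup E] [InnerProductSpace ℝ E] [FiniteDimensional ℝ E]
  [MeasurableSpace E] [BorelSpace E]

/-! ### Forward kernels and their truncation in time -/

/-- The **forward space–time kernel** of a one-parameter family `κ`: the reflection
`fwdKernel κ v = backKernel κ (-v)` of the backward kernel, i.e. `κ τ (-y)` for `τ > 0` and `0`
for `τ ≤ 0`; convolution with it is the forward Duhamel integral
`(fwdKernel κ ⋆ h)(t, x) = ∫_{s<t} ∫ κ(t - s)(y - x) h(s, y) dy ds` (Evans, *PDE*, §2.3.1,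
Duhamel's formula). [folklore] -/
def fwdKernel (κ : ℝ → E → ℝ) (p : ℝ × E) : ℝ :=
  backKernel κ (-p)

/-- The forward kernel **truncated at time `T`**: `fwdKernelCut κ T (τ, y) = fwdKernel κ (τ, y)`
for `τ < T` and `0` for `τ ≥ T`. [folklore] -/
def fwdKernelCut (κ : ℝ → E → ℝ) (T : ℝ) (p : ℝ × E) : ℝ :=
  if p.1 < T then fwdKernel κ p else 0

omit [InnerProductSpace ℝ E] [FiniteDimensional ℝ E] [MeasurableSpace E] [BorelSpace E] in
/-- Unfolding the forward kernel at a positive time. [folklore] -/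
theorem fwdKernel_of_pos (κ : ℝ → E → ℝ) {τ : ℝ} (hτ : 0 < τ) (y : E) :
    fwdKernel κ (τ, y) = κ τ (-y) := by
  simp [fwdKernel, backKernel, hτ]

omit [InnerProductSpace ℝ E] [FiniteDimensional ℝ E] [MeasurableSpace E] [BorelSpace E] in
/-- The forward kernel vanishes at nonpositive times. [folklore] -/
theorem fwdKernel_of_nonpos (κ : ℝ → E → ℝ) {τ : ℝ} (hτ : τ ≤ 0) (y : E) :
    fwdKernel κ (τ, y) = 0 := by
  simp [fwdKernel, backKernel, not_lt.2 hτ]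

omit [InnerProductSpace ℝ E] [FiniteDimensional ℝ E] [MeasurableSpace E] [BorelSpace E] in
/-- The forward kernel as the reflection of the backward kernel. [folklore] -/
theorem fwdKernel_eq_reflect (κ : ℝ → E → ℝ) : fwdKernel κ = fun v => backKernel κ (-v) := rfl

omit [InnerProductSpace ℝ E] [FiniteDimensional ℝ E] [MeasurableSpace E] [BorelSpace E] in
/-- The truncated kernel agrees with the forward kernel before the truncation time. [folklore] -/
theorem fwdKernelCut_of_lt (κ : ℝ → E → ℝ) {T : ℝ} {p : ℝ × E} (hp : p.1 < T) :
    fwdKernelCut κ T p = fwdKernel κ p := by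
  simp [fwdKernelCut, hp]

omit [InnerProductSpace ℝ E] [FiniteDimensional ℝ E] [MeasurableSpace E] [BorelSpace E] in
/-- The truncated kernel vanishes from the truncation time on. [folklore] -/
theorem fwdKernelCut_of_le (κ : ℝ → E → ℝ) {T : ℝ} {p : ℝ × E} (hp : T ≤ p.1) :
    fwdKernelCut κ T p = 0 := by
  simp [fwdKernelCut, not_lt.2 hp]

omit [InnerProductSpace ℝ E] [FiniteDimensional ℝ E] [MeasurableSpace E] [BorelSpace E] in
/-- The truncated kernel at a time in `(0, T)`. [folklore] -/
theorem fwdKernelCut_of_mem (κ : ℝ → E → ℝ) {T τ : ℝ} (hτ : τ ∈ Ioo 0 T) (y : E) :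
    fwdKernelCut κ T (τ, y) = κ τ (-y) := by
  rw [fwdKernelCut_of_lt κ (show (τ, y).1 < T from hτ.2), fwdKernel_of_pos κ hτ.1]

omit [InnerProductSpace ℝ E] [FiniteDimensional ℝ E] [MeasurableSpace E] [BorelSpace E] in
/-- The truncated kernel vanishes at times outside `(0, T)`. [folklore] -/
theorem fwdKernelCut_of_not_mem (κ : ℝ → E → ℝ) {T τ : ℝ} (hτ : τ ∉ Ioo 0 T) (y : E) :
    fwdKernelCut κ T (τ, y) = 0 := by
  by_cases h : τ < T
  · have h0 : τ ≤ 0 := by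
      by_contra h'
      exact hτ ⟨not_le.1 h', h⟩
    rw [fwdKernelCut_of_lt κ (show (τ, y).1 < T from h), fwdKernel_of_nonpos κ h0]
  · exact fwdKernelCut_of_le κ (not_lt.1 h)

omit [InnerProductSpace ℝ E] [FiniteDimensional ℝ E] [MeasurableSpace E] [BorelSpace E] in
/-- The truncated kernel is dominated by the forward kernel. [folklore] -/
theorem abs_fwdKernelCut_le (κ : ℝ → E → ℝ) (T : ℝ) (p : ℝ × E) :
    |fwdKernelCut κ T p| ≤ |fwdKernel κ p| := by
  by_cases h : p.1 < T
  · rw [fwdKernelCut_of_lt κ h]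
  · rw [fwdKernelCut_of_le κ (not_lt.1 h), abs_zero]; exact abs_nonneg _

omit [InnerProductSpace ℝ E] [FiniteDimensional ℝ E] in
/-- Measurability of the forward kernel. [folklore] -/
theorem measurable_fwdKernel {κ : ℝ → E → ℝ} (hκ : Measurable (backKernel κ)) :
    Measurable (fwdKernel κ) :=
  hκ.comp measurable_neg

omit [InnerProductSpace ℝ E] [FiniteDimensional ℝ E] in
/-- Measurability of the truncated forward kernel. [folklore] -/
theorem measurable_fwdKernelCut {κ : ℝ → E → ℝ} (hκ : Measurable (backKernel κ)) (T : ℝ) :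
    Measurable (fwdKernelCut κ T) := by
  have h : fwdKernelCut κ T = ({p : ℝ × E | p.1 < T}).piecewise (fwdKernel κ) 0 := by
    funext p
    by_cases hp : p.1 < T
    · rw [piecewise_eq_of_mem _ _ _ (show p ∈ {p : ℝ × E | p.1 < T} from hp)]
      exact fwdKernelCut_of_lt κ hp
    · rw [piecewise_eq_of_notMem _ _ _ (show p ∉ {p : ℝ × E | p.1 < T} from hp)]
      exact fwdKernelCut_of_le κ (not_lt.1 hp)
  rw [h]
  exact Measurable.piecewise (measurableSet_lt measurable_fst measurable_const)
    (measurable_fwdKernel hκ) measurable_const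

/-! ### The generic `L^s` bound of a truncated forward kernel -/

/-- **Interpolated `L^s` bound for a truncated forward kernel**: if the family satisfies the sup
bound `|κ a y| ≤ B(a)` and the slice bound `∫ |κ a y| dy ≤ N(a)` for `a > 0`, then for `s ≥ 1`
`∫∫ |fwdKernelCut κ T|^s ≤ ∫_{0 < a < T} B(a)^{s-1} N(a) da`
(`|κ|^s = |κ|^{s-1}|κ|`, Tonelli on `ℝ × E`, and the symmetry `y ↦ -y` of Lebesgue measure). [folklore] -/
theorem lintegral_rpow_enorm_fwdKernelCut_le {κ : ℝ → E → ℝ} (hκ : Measurable (backKernel κ))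
    {B N : ℝ → ℝ} (hB : ∀ a, 0 < a → ∀ y, |κ a y| ≤ B a)
    (hN : ∀ a, 0 < a → ∫⁻ y, ‖κ a y‖ₑ ≤ ENNReal.ofReal (N a)) {s : ℝ} (hs : 1 ≤ s) (T : ℝ) :
    ∫⁻ p, ‖fwdKernelCut κ T p‖ₑ ^ s ∂(volume : Measure (ℝ × E)) ≤
      ∫⁻ a in Ioo 0 T, ENNReal.ofReal (B a) ^ (s - 1) * ENNReal.ofReal (N a) := by
  have hs0 : 0 < s := one_pos.trans_le hs
  have hmeas : Measurable (fwdKernelCut κ T) := measurable_fwdKernelCut hκ T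
  -- Tonelli
  rw [Measure.volume_eq_prod, lintegral_prod _ (hmeas.enorm.pow_const _).aemeasurable]
  -- the inner integral for each `a`
  have hinner : ∀ a : ℝ, ∫⁻ y, ‖fwdKernelCut κ T (a, y)‖ₑ ^ s ∂(volume : Measure E) ≤
      (Ioo 0 T).indicator (fun a => ENNReal.ofReal (B a) ^ (s - 1) * ENNReal.ofReal (N a)) a := by
    intro a
    by_cases ha : a ∈ Ioo 0 T
    · rw [indicator_of_mem ha]
      simp_rw [fwdKernelCut_of_mem κ ha]
      have hB' : ∀ y, ‖κ a (-y)‖ₑ ≤ ENNReal.ofReal (B a) := fun y => by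
        rw [Real.enorm_eq_ofReal_abs]
        exact ENNReal.ofReal_le_ofReal (hB a ha.1 (-y))
      calc ∫⁻ y, ‖κ a (-y)‖ₑ ^ s ∂(volume : Measure E)
          = ∫⁻ y, ‖κ a (-y)‖ₑ ^ (s - 1) * ‖κ a (-y)‖ₑ ∂(volume : Measure E) := by
            refine lintegral_congr fun y => ?_
            conv_lhs => rw [show s = (s - 1) + 1 by ring]
            rw [ENNReal.rpow_add_of_nonneg _ _ (by linarith) zero_le_one, ENNReal.rpow_one]
        _ ≤ ∫⁻ y, ENNReal.ofReal (B a) ^ (s - 1) * ‖κ a (-y)‖ₑ ∂(volume : Measure E) := by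
            refine lintegral_mono fun y => ?_
            exact mul_le_mul' (ENNReal.rpow_le_rpow (hB' y) (by linarith)) le_rfl
        _ = ENNReal.ofReal (B a) ^ (s - 1) * ∫⁻ y, ‖κ a y‖ₑ ∂(volume : Measure E) := by
            rw [lintegral_const_mul' _ _ (ENNReal.rpow_ne_top_of_nonneg (by linarith)
              ENNReal.ofReal_ne_top)]
            congr 1
            exact lintegral_neg_eq_self (fun y => ‖κ a y‖ₑ)
        _ ≤ ENNReal.ofReal (B a) ^ (s - 1) * ENNReal.ofReal (N a) :=
            mul_le_mul' le_rfl (hN a ha.1)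
    · rw [indicator_of_notMem ha]
      simp_rw [fwdKernelCut_of_not_mem κ ha]
      simp [ENNReal.zero_rpow_of_pos hs0]
  calc ∫⁻ a, ∫⁻ y, ‖fwdKernelCut κ T (a, y)‖ₑ ^ s ∂volume ∂volume
      ≤ ∫⁻ a, (Ioo 0 T).indicator
          (fun a => ENNReal.ofReal (B a) ^ (s - 1) * ENNReal.ofReal (N a)) a ∂volume :=
        lintegral_mono fun a => hinner a
    _ = ∫⁻ a in Ioo 0 T, ENNReal.ofReal (B a) ^ (s - 1) * ENNReal.ofReal (N a) :=
        lintegral_indicator measurableSet_Ioo _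

/-- A power `a ↦ c * a^e` with `e > -1` has finite `lintegral` of `ofReal` over `(0, T)`. [folklore] -/
theorem lintegral_ofReal_const_mul_rpow_Ioo_lt_top {c e : ℝ} (he : -1 < e) (T : ℝ) :
    ∫⁻ a in Ioo 0 T, ENNReal.ofReal (c * a ^ e) < ⊤ := by
  have h0 : IntegrableOn (fun a : ℝ => c * |a| ^ e) (Icc (-T) T) volume :=
    (integrableOn_abs_rpow_Icc he T).const_mul c
  have hint : IntegrableOn (fun a : ℝ => c * |a| ^ e) (Ioo 0 T) volume :=
    h0.mono_set fun a ha => ⟨by linarith [ha.1, ha.2], ha.2.le⟩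
  have hint' : IntegrableOn (fun a : ℝ => c * a ^ e) (Ioo 0 T) volume := by
    refine hint.congr_fun (fun a ha => ?_) measurableSet_Ioo
    show c * |a| ^ e = c * a ^ e
    rw [abs_of_pos ha.1]
  calc ∫⁻ a in Ioo 0 T, ENNReal.ofReal (c * a ^ e)
      ≤ ∫⁻ a in Ioo 0 T, ‖c * a ^ e‖ₑ := lintegral_mono fun a =>
        (ENNReal.ofReal_le_ofReal (le_abs_self _)).trans_eq (Real.enorm_eq_ofReal_abs _).symm
    _ < ⊤ := hint'.2

/-! ### The heat kernel -/

/-- **The truncated forward heat kernel is in `L^s(ℝ × E)` for `1 ≤ s < 1 + 2/d`**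
(`∫∫ G^s ≤ ∫_0^T (4πa)^{-d(s-1)/2} da < ∞`; in `ℝ³`: `s < 5/3`). [cite: RobinsonRodrigoSadowskiCUP2016, Thm. D.6, proof Case 2 (the power of t of the heat kernel in L^a)] -/
theorem memLp_fwdKernelCut_heatKernel (T : ℝ) {p : ℝ≥0∞} (hp1 : 1 ≤ p) (hptop : p ≠ ⊤)
    (hp : p.toReal < 1 + 2 / (Module.finrank ℝ E : ℝ)) :
    MemLp (fwdKernelCut (UnboundedOperators.heatKernel (E := E)) T) p
      (volume : Measure (ℝ × E)) := by
  set d : ℝ := (Module.finrank ℝ E : ℝ) with hd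
  set s : ℝ := p.toReal with hs
  have hp0 : p ≠ 0 := (zero_lt_one.trans_le hp1).ne'
  have hs1 : 1 ≤ s := by
    have := (ENNReal.toReal_le_toReal ENNReal.one_ne_top hptop).2 hp1
    simpa using this
  have hmeas := measurable_fwdKernelCut (backKernel_heatKernel_props (E := E)).1 T
  refine ⟨hmeas.aestronglyMeasurable, ?_⟩
  rw [eLpNorm_eq_lintegral_rpow_enorm_toReal hp0 hptop]
  refine ENNReal.rpow_lt_top_of_nonneg (by positivity) (lt_top_iff_ne_top.1 ?_)
  -- the exponent of the time integral
  set e : ℝ := -(d / 2) * (s - 1) with he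
  have he1 : -1 < e := by
    have hd0 : 0 ≤ d := by rw [hd]; positivity
    rcases hd0.eq_or_lt with hd00 | hdpos
    · rw [he, ← hd00]; norm_num
    · -- `d(s-1)/2 < 1`
      have h1 : s - 1 < 2 / d := by linarith
      have h2 : d * (s - 1) < 2 := by
        have := (lt_div_iff₀ hdpos).1 h1
        linarith
      rw [he]; nlinarith
  have hbound := lintegral_rpow_enorm_fwdKernelCut_le (E := E)
    (backKernel_heatKernel_props (E := E)).1
    (B := fun a => (4 * π * a) ^ (-d / 2)) (N := fun _ => 1)
    (fun a ha y => by
      rw [abs_of_nonneg (UnboundedOperators.heatKernel_pos ha y).le]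
      exact UnboundedOperators.heatKernel_le ha y)
    (fun a ha => lintegral_enorm_heatKernel_le_one ha) hs1 T
  refine hbound.trans_lt ?_
  -- compare with `c * a^e`
  have hle : ∀ a ∈ Ioo (0 : ℝ) T, ENNReal.ofReal ((4 * π * a) ^ (-d / 2)) ^ (s - 1) *
      ENNReal.ofReal 1 = ENNReal.ofReal ((4 * π) ^ e * a ^ e) := by
    intro a ha
    have ha0 : 0 < a := ha.1
    have h4 : 0 ≤ 4 * π * a := by positivity
    rw [ENNReal.ofReal_one, mul_one, ENNReal.ofReal_rpow_of_nonneg (rpow_nonneg h4 _) (by linarith)]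
    congr 1
    rw [← Real.rpow_mul h4, show -d / 2 * (s - 1) = e by rw [he]; ring,
      Real.mul_rpow (by positivity) ha0.le]
  calc ∫⁻ a in Ioo 0 T, ENNReal.ofReal ((4 * π * a) ^ (-d / 2)) ^ (s - 1) * ENNReal.ofReal 1
      = ∫⁻ a in Ioo 0 T, ENNReal.ofReal ((4 * π) ^ e * a ^ e) :=
        setLIntegral_congr_fun measurableSet_Ioo hle
    _ < ⊤ := lintegral_ofReal_const_mul_rpow_Ioo_lt_top he1 T

/-! ### The heat kernel gradient -/

/-- **The truncated forward heat-gradient kernel is in `L^s(ℝ × E)` for `1 ≤ s < 1 + 1/(d+1)`**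
(`∫∫ |∂ᵥG|^s ≤ C ∫_0^T a^{-((d+1)(s-1)+1)/2} da < ∞`; in `ℝ³`: `s < 5/4`). [cite: RobinsonRodrigoSadowskiCUP2016, Thm. D.7, proof (the power of t of the kernel gradient in L^a)] -/
theorem memLp_fwdKernelCut_heatKernelGrad (v : E) (T : ℝ) {p : ℝ≥0∞} (hp1 : 1 ≤ p)
    (hptop : p ≠ ⊤) (hp : p.toReal < 1 + 1 / ((Module.finrank ℝ E : ℝ) + 1)) :
    MemLp (fwdKernelCut (heatKernelGrad v) T) p (volume : Measure (ℝ × E)) := by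
  set d : ℝ := (Module.finrank ℝ E : ℝ) with hd
  set s : ℝ := p.toReal with hs
  have hp0 : p ≠ 0 := (zero_lt_one.trans_le hp1).ne'
  have hs1 : 1 ≤ s := by
    have := (ENNReal.toReal_le_toReal ENNReal.one_ne_top hptop).2 hp1
    simpa using this
  have hd0 : 0 ≤ d := by rw [hd]; positivity
  have hmeas := measurable_fwdKernelCut (backKernel_heatKernelGrad_props (E := E) v).1 T
  refine ⟨hmeas.aestronglyMeasurable, ?_⟩
  rw [eLpNorm_eq_lintegral_rpow_enorm_toReal hp0 hptop]
  refine ENNReal.rpow_lt_top_of_nonneg (by positivity) (lt_top_iff_ne_top.1 ?_)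
  obtain ⟨C, hC, hCb⟩ := exists_abs_heatKernelGrad_le (E := E)
  -- sup bound `|∂ᵥG_a(y)| ≤ C ‖v‖ a^{-(d+1)/2}`
  have hsup : ∀ a, 0 < a → ∀ y, |heatKernelGrad v a y| ≤ C * ‖v‖ * a ^ (-((d + 1) / 2)) := by
    intro a ha y
    refine (hCb ha v y).trans (mul_le_mul_of_nonneg_left ?_ (by positivity))
    exact Real.rpow_le_rpow_of_nonpos ha (by nlinarith [norm_nonneg y])
      (neg_nonpos.2 (by positivity))
  -- the exponent of the time integral
  set e : ℝ := -((d + 1) / 2) * (s - 1) + -(1 / 2) with he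
  have he1 : -1 < e := by
    have h1 : s - 1 < 1 / (d + 1) := by linarith
    have h2 : (d + 1) * (s - 1) < 1 := by
      have := (lt_div_iff₀ (by positivity : (0 : ℝ) < d + 1)).1 h1
      linarith
    rw [he]; nlinarith
  have hbound := lintegral_rpow_enorm_fwdKernelCut_le (E := E)
    (backKernel_heatKernelGrad_props (E := E) v).1
    (B := fun a => C * ‖v‖ * a ^ (-((d + 1) / 2)))
    (N := fun a => (2 : ℝ) ^ (d / 2) * ‖v‖ * a ^ (-(1 / 2 : ℝ))) hsup
    (fun a ha => lintegral_enorm_heatKernelGrad_le ha v) hs1 T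
  refine hbound.trans_lt ?_
  set c : ℝ := (C * ‖v‖) ^ (s - 1) * ((2 : ℝ) ^ (d / 2) * ‖v‖) with hc
  have hle : ∀ a ∈ Ioo (0 : ℝ) T, ENNReal.ofReal (C * ‖v‖ * a ^ (-((d + 1) / 2))) ^ (s - 1) *
      ENNReal.ofReal ((2 : ℝ) ^ (d / 2) * ‖v‖ * a ^ (-(1 / 2 : ℝ))) = ENNReal.ofReal (c * a ^ e) := by
    intro a ha
    have ha0 : 0 ≤ a := ha.1.le
    have h1 : 0 ≤ C * ‖v‖ * a ^ (-((d + 1) / 2)) := by positivity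
    have h2 : 0 ≤ (2 : ℝ) ^ (d / 2) * ‖v‖ * a ^ (-(1 / 2 : ℝ)) := by positivity
    rw [ENNReal.ofReal_rpow_of_nonneg h1 (by linarith), ← ENNReal.ofReal_mul (rpow_nonneg h1 _)]
    congr 1
    rw [Real.mul_rpow (by positivity) (rpow_nonneg ha0 _), ← Real.rpow_mul ha0, hc, he,
      Real.rpow_add ha.1]
    ring
  calc ∫⁻ a in Ioo 0 T, ENNReal.ofReal (C * ‖v‖ * a ^ (-((d + 1) / 2))) ^ (s - 1) *
        ENNReal.ofReal ((2 : ℝ) ^ (d / 2) * ‖v‖ * a ^ (-(1 / 2 : ℝ)))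
      = ∫⁻ a in Ioo 0 T, ENNReal.ofReal (c * a ^ e) := setLIntegral_congr_fun measurableSet_Ioo hle
    _ < ⊤ := lintegral_ofReal_const_mul_rpow_Ioo_lt_top he1 T

end Literature.Analysis.FluidPDE
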